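import Summits.BirchSwinnertonDyer.BirchSwinnertonDyer.Theorems.KolyvaginRankRigidityAtTwoKolyvaginCorankRigidityAtTwoLowerBoundOfRich
import Summits.BirchSwinnertonDyer.BirchSwinnertonDyer.Theorems.KolyvaginRankRigidityAtTwoStrongSystemOfBoundedDefect
import Summits.BirchSwinnertonDyer.BirchSwinnertonDyer.Theorems.KolyvaginRankRigidityAtTwoKolyvaginCorankLowerBoundAtTwoRichOfProp37
import HarnessLib

/-!
# Crux V2 `KolyvaginCorankRigidityAtTwo` (stmt-BirchSwinnertonDyer-23949), line `kolyvagin_depth_split`, OPEN stub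
# `stub_lowerBoundMinimalPosDepth`: on the 2-split sub-habitat it follows from Gross 1991 Prop. 3.7 (2) and U1
# `KolyvaginBoundedDefectAtTwo` (stmt-28083) ALONE — the by-name certificate

Helper file (`--supports stmt-BirchSwinnertonDyer-23949 --as helper`), ONE THEOREM, no definition, no `sorry`.
Composition of the landed pieces: `lowerBoundMinimalPosDepth_of_rich_of_strongSystem` (this seat: the
margin-0-minimal lower bound from V2♭∞ + V1′∞, via the least rich depth), V2♭∞ from the print fact
(`KolyvaginLowerBoundAtTwo.KolyvaginCorankLowerBoundAtTwoRich_of_prop37`, lead krr2-p1 g8, p641767) and V1′∞ from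
U1 (`KolyvaginAtTwo.KolyvaginSwap.strongNonzeroSystem_of_boundedDefect`, krr2-p2 g22).  So the stub's remaining
content on 2-split `K` is EXACTLY U1 ∧ `Prop37FrobeniusCongruenceAtTwo` (stmt-23091, published, cite-only) — the
same open statement as for the V1′ family.  HONEST FRAMING: CONDITIONAL on the named print fact (conditional-result)
and on the OPEN crux U1; closes no stub (one extra binder `SatisfiesHeegnerHypothesis 2 K`); BSD is NOT proved.

References (locators only): [cite: GrossLMS1991, Prop. 3.7 (2)] [cite: Kolyvagin1991MathAnn, §2 Thm. 2.2, (2.1), Conj. 2.5]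
[cite: McCallumLMS1991, §5 Prop. 5.2].
-/

set_option autoImplicit false
-- the Theorems namespace of this sub repeats the summit name by design (D-0017 nested layout)
set_option linter.dupNamespace false

noncomputable section

open scoped Classical

open WeierstrassCurve Literature.NumberTheory.EllipticCurves
  Literature.NumberTheory.EllipticCurves.ModularForms
open Summit.BirchSwinnertonDyer.BirchSwinnertonDyer.Theses.KolyvaginRankRigidityAtTwo
open Summit.BirchSwinnertonDyer.BirchSwinnertonDyer.Theorems

namespace Summit.BirchSwinnertonDyer.BirchSwinnertonDyer.Theorems.KolyvaginRankRigidity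

/-- **`stub_lowerBoundMinimalPosDepth` on the 2-split sub-habitat from Gross 1991 Prop. 3.7 (2) and U1 alone.**
CONDITIONAL on the named print fact `GrossLMS1991.prop37_2_frobeniusCongruence` (cite-only in the tree) and on
the OPEN crux U1 `KolyvaginBoundedDefectAtTwo` (stmt-28083): V2♭∞ is the landed
`KolyvaginLowerBoundAtTwo.KolyvaginCorankLowerBoundAtTwoRich_of_prop37` (p641767) and V1′∞ the landed
`KolyvaginAtTwo.KolyvaginSwap.strongNonzeroSystem_of_boundedDefect`. Closes nothing; BSD is not proved.
[cite: GrossLMS1991, Prop. 3.7 (2)] [cite: Kolyvagin1991MathAnn, §2 Thm. 2.2, Conj. 2.5] -/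
theorem lowerBoundMinimalPosDepth_of_prop37_of_boundedDefect
    (h37 : Literature.NumberTheory.EllipticCurves.GrossLMS1991.prop37_2_frobeniusCongruence)
    (hU1 : KolyvaginBoundedDefectAtTwo) :
    ∀ (W : WeierstrassCurve ℚ) [W.IsElliptic] [W.IsGloballyMinimal], ¬ W.HasCM →
      (Rank1Residual.GoodOrd W 2 ∨ Rank1Residual.Mult W 2) →
      (∀ m : ℕ, W.HasSurjectiveModNGaloisRep (2 ^ m : ℕ)) →
      ∀ (K : Type) [Field K] [NumberField K], IsImaginaryQuadratic K → NumberField.discr K ≠ -3 →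
      NumberField.discr K ≠ -4 → ¬ ((2 : ℤ) ∣ NumberField.discr K) → ∀ [NeZero (W.conductorNorm ℤ)],
      SatisfiesHeegnerHypothesis (W.conductorNorm ℤ) K → SatisfiesHeegnerHypothesis 2 K →
      ∀ (Dt : ModularParametrizationData W (W.conductorNorm ℤ)) (β : ℤ) (ι : K →+* ℂ) (n : ℕ)
        (d : KolyvaginHeegnerData Dt β ι n) (M : ℕ),
        KolyvaginDescent.KolSupp (Zhang2014.IsKolyvaginPrime (W.conductorNorm ℤ) W K 2) n →
        1 ≤ M → (M : ℕ∞) ≤ Zhang2014.levelIndex W 2 n → d.kolyvaginClass Nat.prime_two M ≠ 0 →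
        (∀ (n' : ℕ) (d' : KolyvaginHeegnerData Dt β ι n') (M' : ℕ),
          KolyvaginDescent.KolSupp (Zhang2014.IsKolyvaginPrime (W.conductorNorm ℤ) W K 2) n' →
          1 ≤ M' → (M' : ℕ∞) ≤ Zhang2014.levelIndex W 2 n' → d'.kolyvaginClass Nat.prime_two M' ≠ 0 →
          n.primeFactors.card ≤ n'.primeFactors.card) →
        1 ≤ n.primeFactors.card →
        (n.primeFactors.card + 1 ≤ W.selmerCorank 2 ∨
          n.primeFactors.card + 1 ≤ (W.quadraticTwist (NumberField.discr K : ℚ)).selmerCorank 2) :=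
  lowerBoundMinimalPosDepth_of_rich_of_strongSystem
    (KolyvaginLowerBoundAtTwo.KolyvaginCorankLowerBoundAtTwoRich_of_prop37 h37)
    (KolyvaginAtTwo.KolyvaginSwap.strongNonzeroSystem_of_boundedDefect hU1)

end Summit.BirchSwinnertonDyer.BirchSwinnertonDyer.Theorems.KolyvaginRankRigidity

end
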